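import Mathlib.Algebra.BigOperators.Ring.Finset
import Mathlib.Algebra.Order.BigOperators.Ring.Finset
import Mathlib.Data.Real.Basic
import Mathlib.Tactic.Linarith
import Mathlib.Tactic.Ring
import Mathlib.Tactic.Positivity

import HarnessLib
import HarnessLib.Audit

/-!
# `NoHeavyLowerTail` (crux stmt-CriticalPhenomena-4575), Sahi programme P4 (Holley / monotone coupling):
# the dimer OR-step `(x ∧ y) ∨ G`, file 2 — the mass inequalities that pay for the antichain

Support file (cell `prim-l12`, seat P4, generation 14; `--supports stmt-CriticalPhenomena-4575`).  No named facts, no sorries;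
standard axioms; def-free.

Context (HOME prim-l12-p4/FROM-prim-l12-p4-gen14-DIMER-REDUCTION.md, §3).  In the pair inequality of the flat composite certificate
of `(x ∧ y) ∨ G` the packing residual is bounded below by `−[π_N + d′ π_N′]/(1+d′)` (`…SahiE3DimerPacking` plus the inner pair
inequalities and the cap); the two penalties are then paid by two elementary mass facts, recorded here in the form the certificate
file will consume:
* `mod_sum_nonneg`, `mod_sum_ge_cross` — the "modularity" cell sums
  `ν(S_t∩S′_t∩G) + ν(S_β∩S′_β∩G) − ν(S_t∩S′_β∩G) − ν(S′_t∩S_β∩G) = ν((S_t∖S_β)∩(S′_t∖S′_β)∩G) ≥ 0`, and for `β = o` the lower bound by the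
  mass of the two CROSSING CELLS `(S_a∖S_b)∩(S′_b∖S′_a)`, `(S_b∖S_a)∩(S′_a∖S′_b)` (this pays `π_N/(1+d′)`);
* `sdiff_sum_le_sub`, `two_sdiff_sum_le_sub` — section differences dominate the masses of `S_a∖S_b`, `S_b∖S_a`;
* `dimer_Td_bound` — the product expansion `(q̄X_t−⟨X⟩)(q̄X′_t−⟨X′⟩) ≥ (ν_o q̄ + ν_aν_b)(x₁y₁ + x₂y₂)` (this pays `d′π_N′/(1+d′)`);
* `need_sdiff_le` — `n(D,D′) ≤ (Z′+N′_D)·ν(D)ν(D′)` for the bilinear need form on arbitrary sets.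
All statements are about a weight `ν ≥ 0` on a finite type and finite sets; proofs are pointwise sign checks or `nlinarith`.
-/

namespace Summit.CriticalPhenomena.PercolationContinuityZ3.Theorems.SahiE3DimerMass

open Finset
open scoped BigOperators

variable {Q : Type*} [DecidableEq Q]

/-- A sum over `X ∩ G` as a sum over `G` of an indicator-weighted function. [folklore] -/
theorem sum_inter_eq_sum_ite' (ν : Q → ℝ) (X G : Finset Q) :
    ∑ t ∈ X ∩ G, ν t = ∑ t ∈ G, (if t ∈ X then ν t else 0) := by
  rw [Finset.inter_comm, ← Finset.filter_mem_eq_inter, Finset.sum_filter]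

/-- **Modularity cell sum.**  For `S_β ⊆ S_t`, `S′_β ⊆ S′_t` and `ν ≥ 0` on `G`:
`ν(S_t∩S′_t∩G) + ν(S_β∩S′_β∩G) ≥ ν(S_t∩S′_β∩G) + ν(S′_t∩S_β∩G)` (the difference is the mass of `(S_t∖S_β)∩(S′_t∖S′_β)∩G`). [folklore] -/
theorem mod_sum_nonneg (ν : Q → ℝ) (G St Sβ Tt Tβ : Finset Q) (hν : ∀ t ∈ G, 0 ≤ ν t)
    (hS : Sβ ⊆ St) (hT : Tβ ⊆ Tt) :
    ∑ t ∈ (St ∩ Tβ) ∩ G, ν t + ∑ t ∈ (Sβ ∩ Tt) ∩ G, ν t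
      ≤ ∑ t ∈ (St ∩ Tt) ∩ G, ν t + ∑ t ∈ (Sβ ∩ Tβ) ∩ G, ν t := by
  simp only [sum_inter_eq_sum_ite']
  rw [← Finset.sum_add_distrib, ← Finset.sum_add_distrib]
  refine Finset.sum_le_sum fun t ht => ?_
  have hνt := hν t ht
  simp only [Finset.mem_inter]
  by_cases h1 : t ∈ St <;> by_cases h2 : t ∈ Sβ <;> by_cases h3 : t ∈ Tt <;> by_cases h4 : t ∈ Tβ <;>
    simp only [h1, h2, h3, h4, and_true, and_false, and_self, ↓reduceIte] <;>
    first
      | exact absurd (hS h2) h1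
      | exact absurd (hT h4) h3
      | linarith

/-- **The bottom modularity cell contains the crossing cells.**  For sections `S_o ⊆ S_b`, `S_o ⊆ S_a`… precisely: `S_o ⊆ S_a ∩ S_b`-type
nesting `So ⊆ Sb`, `Sa ⊆ St`, `Sb ⊆ St` (and the same for `T`) and `ν ≥ 0` on `G`:
`ν(S_t∩S′_t∩G) + ν(S_o∩S′_o∩G) − ν(S_t∩S′_o∩G) − ν(S′_t∩S_o∩G) ≥ ν((S_a∖S_b)∩(S′_b∖S′_a)∩G) + ν((S_b∖S_a)∩(S′_a∖S′_b)∩G)`. [this work] -/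
theorem mod_sum_ge_cross (ν : Q → ℝ) (G So Sa Sb St To Ta Tb Tt : Finset Q) (hν : ∀ t ∈ G, 0 ≤ ν t)
    (hSoa : So ⊆ Sa) (hSob : So ⊆ Sb) (hSat : Sa ⊆ St) (hSbt : Sb ⊆ St)
    (hToa : To ⊆ Ta) (hTob : To ⊆ Tb) (hTat : Ta ⊆ Tt) (hTbt : Tb ⊆ Tt) :
    ∑ t ∈ (St ∩ To) ∩ G, ν t + ∑ t ∈ (So ∩ Tt) ∩ G, ν t
      + (∑ t ∈ ((Sa \ Sb) ∩ (Tb \ Ta)) ∩ G, ν t + ∑ t ∈ ((Sb \ Sa) ∩ (Ta \ Tb)) ∩ G, ν t)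
      ≤ ∑ t ∈ (St ∩ Tt) ∩ G, ν t + ∑ t ∈ (So ∩ To) ∩ G, ν t := by
  simp only [sum_inter_eq_sum_ite']
  rw [← Finset.sum_add_distrib, ← Finset.sum_add_distrib, ← Finset.sum_add_distrib, ← Finset.sum_add_distrib]
  refine Finset.sum_le_sum fun t ht => ?_
  have hνt := hν t ht
  simp only [Finset.mem_inter, Finset.mem_sdiff]
  by_cases hso : t ∈ So <;> by_cases hsa : t ∈ Sa <;> by_cases hsb : t ∈ Sb <;> by_cases hst : t ∈ St <;>
    by_cases hto : t ∈ To <;> by_cases hta : t ∈ Ta <;> by_cases htb : t ∈ Tb <;> by_cases htt : t ∈ Tt <;>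
    simp only [hso, hsa, hsb, hst, hto, hta, htb, htt, and_true, and_false, and_self, not_true_eq_false,
      not_false_eq_true, ↓reduceIte] <;>
    first
      | exact absurd (hSoa hso) hsa
      | exact absurd (hSob hso) hsb
      | exact absurd (hSat hsa) hst
      | exact absurd (hSbt hsb) hst
      | exact absurd (hToa hto) hta
      | exact absurd (hTob hto) htb
      | exact absurd (hTat hta) htt
      | exact absurd (hTbt htb) htt
      | linarith

/-- Mass of a difference of sections is dominated by a difference of section masses: `Sa ⊆ St`, `ν ≥ 0` ⟹
`ν(Sa ∖ Sb) ≤ ν(St) − ν(Sb)`. [folklore] -/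
theorem sdiff_sum_le_sub [Fintype Q] (ν : Q → ℝ) (hν : ∀ t, 0 ≤ ν t) (Sa Sb St : Finset Q)
    (hSat : Sa ⊆ St) (hSbt : Sb ⊆ St) :
    ∑ t ∈ Sa \ Sb, ν t ≤ ∑ t ∈ St, ν t - ∑ t ∈ Sb, ν t := by
  have h1 : ∑ t ∈ St, ν t = ∑ t ∈ St \ Sb, ν t + ∑ t ∈ Sb, ν t := by
    rw [← Finset.sum_sdiff hSbt]
  have h2 : ∑ t ∈ Sa \ Sb, ν t ≤ ∑ t ∈ St \ Sb, ν t :=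
    Finset.sum_le_sum_of_subset_of_nonneg (Finset.sdiff_subset_sdiff hSat le_rfl) (fun t _ _ => hν t)
  linarith

/-- Both differences at once: `So ⊆ Sa ∩ Sb`, `Sa, Sb ⊆ St`, `ν ≥ 0` ⟹ `ν(Sa ∖ Sb) + ν(Sb ∖ Sa) ≤ ν(St) − ν(So)`. [folklore] -/
theorem two_sdiff_sum_le_sub [Fintype Q] (ν : Q → ℝ) (hν : ∀ t, 0 ≤ ν t) (So Sa Sb St : Finset Q)
    (hSoa : So ⊆ Sa) (hSob : So ⊆ Sb) (hSat : Sa ⊆ St) (hSbt : Sb ⊆ St) :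
    ∑ t ∈ Sa \ Sb, ν t + ∑ t ∈ Sb \ Sa, ν t ≤ ∑ t ∈ St, ν t - ∑ t ∈ So, ν t := by
  have hSot : So ⊆ St := hSoa.trans hSat
  have h1 : ∑ t ∈ St, ν t = ∑ t ∈ St \ So, ν t + ∑ t ∈ So, ν t := by
    rw [← Finset.sum_sdiff hSot]
  have hdisj : Disjoint (Sa \ Sb) (Sb \ Sa) := by
    rw [Finset.disjoint_left]
    intro t h1' h2'
    exact (Finset.mem_sdiff.1 h1').2 (Finset.mem_sdiff.1 h2').1
  have hsub : (Sa \ Sb) ∪ (Sb \ Sa) ⊆ St \ So := by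
    intro t ht'
    rcases Finset.mem_union.1 ht' with h | h
    · exact Finset.mem_sdiff.2 ⟨hSat (Finset.mem_sdiff.1 h).1, fun hso => (Finset.mem_sdiff.1 h).2 (hSob hso)⟩
    · exact Finset.mem_sdiff.2 ⟨hSbt (Finset.mem_sdiff.1 h).1, fun hso => (Finset.mem_sdiff.1 h).2 (hSoa hso)⟩
  have h2 : ∑ t ∈ (Sa \ Sb) ∪ (Sb \ Sa), ν t ≤ ∑ t ∈ St \ So, ν t :=
    Finset.sum_le_sum_of_subset_of_nonneg hsub (fun t _ _ => hν t)
  rw [Finset.sum_union hdisj] at h2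
  linarith

/-- **The `T_d` bound.**  If `L ≥ ν_o(x₁+x₂) + ν_b x₁ + ν_a x₂` and `L′ ≥ ν_o(y₁+y₂) + ν_a y₁ + ν_b y₂` with everything nonnegative, then
`L·L′ ≥ (ν_o(ν_o+ν_a+ν_b) + ν_aν_b)·(x₁y₁ + x₂y₂)` (drop the cross terms of the product). [this work] -/
theorem dimer_Td_bound {νo νa νb x₁ x₂ y₁ y₂ L L' : ℝ} (hνo : 0 ≤ νo) (hνa : 0 ≤ νa) (hνb : 0 ≤ νb)
    (hx₁ : 0 ≤ x₁) (hx₂ : 0 ≤ x₂) (hy₁ : 0 ≤ y₁) (hy₂ : 0 ≤ y₂)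
    (hL : νo * (x₁ + x₂) + νb * x₁ + νa * x₂ ≤ L) (hL' : νo * (y₁ + y₂) + νa * y₁ + νb * y₂ ≤ L') :
    (νo * (νo + νa + νb) + νa * νb) * (x₁ * y₁ + x₂ * y₂) ≤ L * L' := by
  have hA : 0 ≤ νo * (x₁ + x₂) + νb * x₁ + νa * x₂ := by positivity
  have hB : 0 ≤ νo * (y₁ + y₂) + νa * y₁ + νb * y₂ := by positivity
  have hprod : (νo * (x₁ + x₂) + νb * x₁ + νa * x₂) * (νo * (y₁ + y₂) + νa * y₁ + νb * y₂) ≤ L * L' :=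
    mul_le_mul hL hL' hB (hA.trans hL)
  nlinarith [mul_nonneg (mul_nonneg hνo hνo) (mul_nonneg hx₁ hy₂), mul_nonneg (mul_nonneg hνo hνo) (mul_nonneg hx₂ hy₁),
    mul_nonneg (mul_nonneg hνo hνb) (mul_nonneg hx₁ hy₂), mul_nonneg (mul_nonneg hνo hνa) (mul_nonneg hx₂ hy₁),
    mul_nonneg (mul_nonneg hνo hνb) (mul_nonneg hx₂ hy₂), mul_nonneg (mul_nonneg hνo hνa) (mul_nonneg hx₁ hy₁),
    mul_nonneg (mul_nonneg hνo hνb) (mul_nonneg hx₁ hy₁), mul_nonneg (mul_nonneg hνo hνa) (mul_nonneg hx₂ hy₂),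
    mul_nonneg (mul_nonneg hνo hνb) (mul_nonneg hx₂ hy₁), mul_nonneg (mul_nonneg hνo hνa) (mul_nonneg hx₁ hy₂),
    mul_nonneg (mul_nonneg hνb hνb) (mul_nonneg hx₁ hy₂), mul_nonneg (mul_nonneg hνa hνa) (mul_nonneg hx₂ hy₁),
    mul_nonneg (mul_nonneg hνa hνb) (mul_nonneg hx₁ hy₁), mul_nonneg (mul_nonneg hνa hνb) (mul_nonneg hx₂ hy₂)]

/-- **Need of a pair of arbitrary sets.**  The bilinear need form `Z′·(ν(D)ν(D′∩G) + ν(D′)ν(D∩G)) − N′_G·ν(D)ν(D′)` is at most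
`(Z′ + N′_D)·ν(D)ν(D′)` when `ν(D∩G) ≤ ν(D)`, `ν(D′∩G) ≤ ν(D′)`, `Z′ = N′_G + N′_D`, all masses nonnegative. [this work] -/
theorem need_sdiff_le {Z NG ND x xG y yG : ℝ} (hZ : Z = NG + ND) (hNG : 0 ≤ NG) (hND : 0 ≤ ND)
    (hx : 0 ≤ x) (hy : 0 ≤ y) (hxG' : xG ≤ x) (hyG' : yG ≤ y) :
    Z * (x * yG + y * xG) - NG * x * y ≤ (Z + ND) * (x * y) := by
  subst hZ
  nlinarith [mul_nonneg hNG (mul_nonneg hx (sub_nonneg.2 hyG')), mul_nonneg hND (mul_nonneg hx (sub_nonneg.2 hyG')),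
    mul_nonneg hNG (mul_nonneg hy (sub_nonneg.2 hxG')), mul_nonneg hND (mul_nonneg hy (sub_nonneg.2 hxG')),
    mul_nonneg hNG (mul_nonneg hx hy)]

end Summit.CriticalPhenomena.PercolationContinuityZ3.Theorems.SahiE3DimerMass
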